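import Mathlib
import HarnessLib
import Summits.NavierStokesRegularity.NavierStokesRegularity.Theorems.UnthreadedRigidityDoorUnthreadedRigidityVirialHornTwoChannelCascade

/-!
# Route `UnthreadedRigidityDoor`, item `UnthreadedRigidity` (W2, stmt-NavierStokesRegularity-27585) — LINE g11-1 «VIRIAL HORN»,
# BRIDGE V for PLATEAU PROFILES («TWO-CHANNEL RIGIDITY»): THE HYPOTHESIS `TwoChannel` IS NOT VACUOUS — the sectoral harmonic of degree three

Prover file (W2 Lean hand ns-crc-p1 g10, by lineage; `--supports stmt-NavierStokesRegularity-27585 --as helper`; objects BY NAME in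
`Theorems/UnthreadedRigidityDoorUnthreadedRigidityVirialHornTwoChannelDefs.lean`, p726708).

Content: ★ `twoChannel_sectoral_three : TwoChannel 3 (evalE (X₀³ − 3X₀X₁²))` — for the sectoral solid harmonic `Y = x³ − 3xy²` the two
brackets are `{Y, Δ(Y²)} = z(648x⁴y + 432x²y³ − 216y⁵)` and `{Y, Δ²(Y²)} = z(5184x²y − 1728y³)` (`Δ(Y²) = 18(x²+y²)²`,
`Δ²(Y²) = 288(x²+y²)`); evaluating a vanishing combination at the unit vectors `(1,2,2)/3` and `(2,2,1)/3` gives an invertible `2 × 2`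
system, so `θ₁ = θ₂ = 0`.  (Generic harmonics of every degree `l ≥ 3` are two-channel — exact linear algebra, folder tools/run_hyp.py of
the seat; the polyhedral `xyz` is not: `not_twoChannel_xyz` in `…TwoChannelRigidity`.)

HONEST LABEL: polynomial arithmetic; a piece of the L-part of ONE bridge of a RUNG line about SPECIAL (separable) slice data;
`UnthreadedRigidity` (27585), W2 and NS regularity remain OPEN; nothing here is a statement about Navier–Stokes dynamics.  0 kit.
-/

-- the summit and its single sub-problem share the name (CONVENTIONS §1), as in every Theorems file
set_option linter.dupNamespace false

namespace Summit.NavierStokesRegularity.NavierStokesRegularity.Theorems.UnthreadedRigidity.VirialHorn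

open scoped RealInnerProductSpace Topology
open Filter Set MvPolynomial
open Summit.NavierStokesRegularity.NavierStokesRegularity.Theorems.UnthreadedRigidity.ProfileHorn (E3)
open Summit.NavierStokesRegularity.NavierStokesRegularity.Theorems.PoloidalLiouville.HorizonTower hiding E3

/-- ★ THE SECTORAL HARMONIC OF DEGREE THREE IS TWO-CHANNEL: `TwoChannel 3 (x³ − 3xy²)`. -/
theorem twoChannel_sectoral_three :
    TwoChannel 3 (Zonal.evalE (X 0 * X 0 * X 0 - C 3 * X 0 * X 1 * X 1 : MvPolynomial (Fin 3) ℝ)) := by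
  set P : MvPolynomial (Fin 3) ℝ := X 0 * X 0 * X 0 - C 3 * X 0 * X 1 * X 1 with hPdef
  have h3 : (C (3 : ℝ) : MvPolynomial (Fin 3) ℝ) = 3 := map_ofNat C 3
  have hlap : Zonal.lapP P = 0 := by
    simp [hPdef, Zonal.lapP]
    rw [h3]
    ring
  -- the three brackets, explicitly
  have h00 : Zonal.detP P (P * P) = 0 := by
    simp only [Zonal.detP, MvPolynomial.pderiv_mul]
    ring
  have hA0 : ∀ y : E3, pbr (Zonal.evalE P) (sqLapF (Zonal.evalE P) 0) y = 0 := by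
    intro y
    rw [pbr_sqLapF_evalE, sqLapP_zero, h00]
    simp [Zonal.evalE]
  have hA1 : ∀ y : E3, pbr (Zonal.evalE P) (sqLapF (Zonal.evalE P) 1) y =
      648 * y 0 ^ 4 * y 1 * y 2 + 432 * y 0 ^ 2 * y 1 ^ 3 * y 2 - 216 * y 1 ^ 5 * y 2 := by
    intro y
    rw [pbr_sqLapF_evalE, sqLapP_one hlap, show (2 : MvPolynomial (Fin 3) ℝ) = C 2 from (map_ofNat C 2).symm]
    simp [Zonal.detP, Zonal.dotP, Zonal.evalE, hPdef]
    ring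
  have hA2 : ∀ y : E3, pbr (Zonal.evalE P) (sqLapF (Zonal.evalE P) 2) y =
      5184 * y 0 ^ 2 * y 1 * y 2 - 1728 * y 1 ^ 3 * y 2 := by
    intro y
    rw [pbr_sqLapF_evalE, sqLapP_two hlap, show (4 : MvPolynomial (Fin 3) ℝ) = C 4 from (map_ofNat C 4).symm]
    simp [hessSqP, Fin.sum_univ_three, Zonal.detP, Zonal.evalE, hPdef]
    ring
  intro θ hθ
  -- two unit vectors
  set y₁ : E3 := WithLp.toLp 2 ![(1 : ℝ) / 3, 2 / 3, 2 / 3] with hy₁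
  set y₂ : E3 := WithLp.toLp 2 ![(2 : ℝ) / 3, 2 / 3, 1 / 3] with hy₂
  have c10 : y₁ 0 = 1 / 3 := rfl
  have c11 : y₁ 1 = 2 / 3 := rfl
  have c12 : y₁ 2 = 2 / 3 := rfl
  have c20 : y₂ 0 = 2 / 3 := rfl
  have c21 : y₂ 1 = 2 / 3 := rfl
  have c22 : y₂ 2 = 1 / 3 := rfl
  have hn : ∀ y : E3, y 0 ^ 2 + y 1 ^ 2 + y 2 ^ 2 = 1 → ‖y‖ = 1 := by
    intro y hy
    rw [EuclideanSpace.norm_eq, Fin.sum_univ_three]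
    simp only [Real.norm_eq_abs, sq_abs]
    rw [hy, Real.sqrt_one]
  have hn₁ : ‖y₁‖ = 1 := hn y₁ (by rw [c10, c11, c12]; norm_num)
  have hn₂ : ‖y₂‖ = 1 := hn y₂ (by rw [c20, c21, c22]; norm_num)
  have h1 := hθ y₁ hn₁
  have h2 := hθ y₂ hn₂
  simp only [Finset.sum_range_succ, Finset.sum_range_zero, zero_add, hA0, hA1, hA2, mul_zero, c10, c11, c12,
    c20, c21, c22] at h1 h2
  norm_num at h1 h2
  constructor <;> linarith

end Summit.NavierStokesRegularity.NavierStokesRegularity.Theorems.UnthreadedRigidity.VirialHorn
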